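import Summits.PneNP.PneNP.Theorems.Nc03AvoidResidualCoreCandMatchRung
import Summits.PneNP.PneNP.Theorems.Nc03AvoidResidualCoreCandFewHeadsRungFPSearch

/-!
# Route Nc03AvoidResidualCore — the matching-class rung LITERALLY TYPED, part 1/2: the aligned-pack search on token data

Tribunal-w (D-0033 T3), generation 3, for `route-PneNP-Nc03AvoidResidualCore`, item `stmt-PneNP-20226`
(`CandAvoidLinearFP = LocalAvoidLinearFP 3 (IsPure candPred)`). The matching-class rung
`Nc03AvoidResidualCoreCandMatchRung.candMatch_rung` exhibits an explicit avoiding POINT; this file and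
`Nc03AvoidResidualCoreCandMatchRungFP` re-type it in the crux's own typing, `LocalAvoidLinearFP 3
(IsPure candPred ∧ IsMatchingClass ∧ headCount³ ≤ k·n)`: ONE polynomial-time STRING function.

Here: the aligned-pack test `packN` and the certificate answer `ansBitN` / `ansPackN` as Boolean
functions of the ℕ-valued token data (decoder of `Nc03AvoidResidualCoreCandFewHeadsRungFPDecode`:
`runs`, `tripsTok`, `trips`, `tri`), the candidate list `cands m` (all 8-lists of output index
triples, by three doublings), and their agreement with the `Fin`-level `packB` / `packAnswer` of
`Nc03AvoidResidualCoreCandMatchRungPack` on the image `lOf t` of a pack (`packN_lOf`, `ansBitN_lOf`,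
`mem_cands`, `exists_eq_lOf`); whence `answer2_not_mem_range` (soundness from
`packAnswer_not_mem_range`, completeness from `exists_pack`) and the string function `avoidStr2`.
Part 2 types `avoidStr2` in the `CodeFP` algebra.

Restricted-model algorithmic rung of the range-avoidance ladder; no bearing on `P` versus `NP`.
-/

set_option linter.dupNamespace false -- `Summit.PneNP.PneNP.…`: summit = sub-problem name (D-0017 single-conjunct layout)

namespace Summit.PneNP.PneNP.Theorems.Nc03AvoidResidualCoreCandMatchRungFP

open Finset
open Literature.Computability.Complexity
open Summit.PneNP.PneNP.Theorems.Nc03AvoidResidualCoreCandFewHeadsRung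
open Summit.PneNP.PneNP.Theorems.Nc03AvoidResidualCoreCandFewHeadsRungFP
open Summit.PneNP.PneNP.Theorems.Nc03AvoidResidualCoreCandMatchRung

variable {n m : ℕ}

/-! ## The candidate packs on index data -/

/-- All output index triples `(ju, j, jv)` with entries `< m`. -/
def tripsR (m : ℕ) : List (ℕ × ℕ × ℕ) := (List.range m).product (pairsR m)

/-- Doubling a family of lists: all concatenations of two members. -/
def dbl (Ls : List (List (ℕ × ℕ × ℕ))) : List (List (ℕ × ℕ × ℕ)) := (Ls.product Ls).map fun p => p.1 ++ p.2

/-- The candidate packs: all `8`-lists of output index triples (`m²⁴` of them). -/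
def cands (m : ℕ) : List (List (ℕ × ℕ × ℕ)) := dbl (dbl (dbl ((tripsR m).map fun g => [g])))

/-- An index triple is in range. -/
def InR (m : ℕ) (g : ℕ × ℕ × ℕ) : Prop := g.1 < m ∧ g.2.1 < m ∧ g.2.2 < m

/-- Membership in `tripsR`. -/
theorem mem_tripsR {g : ℕ × ℕ × ℕ} : g ∈ tripsR m ↔ InR m g := by
  obtain ⟨a, b, c⟩ := g
  simp [tripsR, pairsR, InR, List.pair_mem_product, List.mem_range]

/-- Membership in a doubling of a family of `c`-lists of in-range triples. -/
theorem mem_dbl {Ls : List (List (ℕ × ℕ × ℕ))} {c : ℕ}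
    (hLs : ∀ a, a ∈ Ls ↔ a.length = c ∧ ∀ g ∈ a, InR m g) (l : List (ℕ × ℕ × ℕ)) :
    l ∈ dbl Ls ↔ l.length = c + c ∧ ∀ g ∈ l, InR m g := by
  constructor
  · intro hl
    obtain ⟨⟨a, b⟩, hab, rfl⟩ := List.mem_map.mp hl
    obtain ⟨ha, hb⟩ := List.pair_mem_product.mp hab
    obtain ⟨hal, hag⟩ := (hLs a).mp ha
    obtain ⟨hbl, hbg⟩ := (hLs b).mp hb
    refine ⟨by simp [hal, hbl], fun g hg => ?_⟩
    rcases List.mem_append.mp hg with h | h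
    · exact hag g h
    · exact hbg g h
  · rintro ⟨hl, hg⟩
    refine List.mem_map.mpr ⟨(l.take c, l.drop c), List.pair_mem_product.mpr ⟨?_, ?_⟩, List.take_append_drop c l⟩
    · exact (hLs _).mpr ⟨by simp [hl], fun g h => hg g (List.mem_of_mem_take h)⟩
    · exact (hLs _).mpr ⟨by simp [hl], fun g h => hg g (List.mem_of_mem_drop h)⟩

/-- **Membership in the candidate list**: exactly the `8`-lists of in-range triples. -/
theorem mem_cands (l : List (ℕ × ℕ × ℕ)) : l ∈ cands m ↔ l.length = 8 ∧ ∀ g ∈ l, InR m g := by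
  have h1 : ∀ a, a ∈ (tripsR m).map (fun g => [g]) ↔ a.length = 1 ∧ ∀ g ∈ a, InR m g := by
    intro a
    constructor
    · intro ha
      obtain ⟨g, hg, rfl⟩ := List.mem_map.mp ha
      exact ⟨rfl, fun g' hg' => by rw [List.mem_singleton.mp hg']; exact mem_tripsR.mp hg⟩
    · rintro ⟨hal, hag⟩
      obtain ⟨g, rfl⟩ := List.length_eq_one_iff.mp hal
      exact List.mem_map.mpr ⟨g, mem_tripsR.mpr (hag g (List.mem_singleton_self g)), rfl⟩
  have h2 := mem_dbl (m := m) h1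
  have h4 := mem_dbl (m := m) h2
  have h8 := mem_dbl (m := m) h4
  exact h8 l

/-- The index triple of a `Fin`-level output triple. -/
def natTrip (g : Fin m × Fin m × Fin m) : ℕ × ℕ × ℕ := (g.1.val, g.2.1.val, g.2.2.val)

/-- The `8`-list of a pack. -/
def lOf (t : Pack m) : List (ℕ × ℕ × ℕ) := (List.finRange 8).map fun i => natTrip (t i)

/-- The list of a pack has length `8`. -/
@[simp] theorem length_lOf (t : Pack m) : (lOf t).length = 8 := by simp [lOf]

/-- Entry `i` of the list of a pack. -/
@[simp] theorem tri_lOf (t : Pack m) (i : Fin 8) : tri (lOf t) i.val = natTrip (t i) := by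
  have hi : i.val < ((List.finRange 8).map fun i => natTrip (t i)).length := by simp
  rw [tri, lOf, List.getD_eq_getElem _ _ hi, List.getElem_map, List.getElem_finRange]
  exact congrArg (fun j => natTrip (t j)) (Fin.ext rfl)

/-- Entry `0` of the list of a pack. -/
@[simp] theorem tri_lOf_zero (t : Pack m) : tri (lOf t) 0 = natTrip (t 0) := tri_lOf t 0

/-- The list of a pack is a candidate. -/
theorem lOf_mem (t : Pack m) : lOf t ∈ cands m := by
  refine (mem_cands _).mpr ⟨length_lOf t, fun g hg => ?_⟩
  obtain ⟨i, _, rfl⟩ := List.mem_map.mp hg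
  exact ⟨(t i).1.isLt, (t i).2.1.isLt, (t i).2.2.isLt⟩

/-- Every candidate is the list of a pack. -/
theorem exists_eq_lOf {l : List (ℕ × ℕ × ℕ)} (hl : l ∈ cands m) : ∃ t : Pack m, l = lOf t := by
  obtain ⟨hlen, hg⟩ := (mem_cands l).mp hl
  have hi : ∀ i : Fin 8, i.val < l.length := fun i => by rw [hlen]; exact i.isLt
  have hR : ∀ i : Fin 8, InR m (l[i.val]'(hi i)) := fun i => hg _ (List.getElem_mem _)
  refine ⟨fun i => (⟨(l[i.val]'(hi i)).1, (hR i).1⟩, ⟨(l[i.val]'(hi i)).2.1, (hR i).2.1⟩,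
    ⟨(l[i.val]'(hi i)).2.2, (hR i).2.2⟩), List.ext_getElem (by simp [hlen]) fun k hk hk' => ?_⟩
  have hk8 : k < 8 := by simpa using hk'
  simp only [lOf, natTrip, List.getElem_map, List.getElem_finRange]
  rfl

/-! ## The aligned-pack test and the answer on token data -/

/-- The positions `0 … 7`. -/
def R8 : List ℕ := List.range 8

/-- The position pairs. -/
def R88 : List (ℕ × ℕ) := R8.product R8

/-- Quantifying over `R8` is quantifying over `Fin 8`. -/
theorem forall_R8 {P : ℕ → Prop} : (∀ i, i ∈ R8 → P i) ↔ ∀ i : Fin 8, P i.val :=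
  ⟨fun h i => h i.val (List.mem_range.mpr i.isLt), fun h i hi => h ⟨i, List.mem_range.mp hi⟩⟩

/-- Quantifying over `R88` is quantifying over `Fin 8 × Fin 8`. -/
theorem forall_R88 {P : ℕ × ℕ → Prop} : (∀ p, p ∈ R88 → P p) ↔ ∀ i i' : Fin 8, P (i.val, i'.val) :=
  ⟨fun h i i' => h _ (List.pair_mem_product.mpr ⟨List.mem_range.mpr i.isLt, List.mem_range.mpr i'.isLt⟩),
    fun h p hp => by
      obtain ⟨a, b⟩ := p
      obtain ⟨ha, hb⟩ := List.pair_mem_product.mp hp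
      exact h ⟨a, List.mem_range.mp ha⟩ ⟨b, List.mem_range.mp hb⟩⟩

/-- `w` is a data vertex (role `1` or `2`) of output `j`, on token data. -/
def memN (L : List (ℕ × ℕ × ℕ)) (w j : ℕ) : Bool := decide (w = (tri L j).2.1) || decide (w = (tri L j).2.2)

/-- **The aligned-pack test on token data** (`L` = output triples, `l` = the eight index triples
`(ju, j, jv)`): the clauses of `packB`, position by position. -/
def packN (L l : List (ℕ × ℕ × ℕ)) : Bool :=
  (R8.all fun i => decide ((tri L (tri l i).2.1).1 = (tri L (tri l 0).2.1).1)) &&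
  (R8.all fun i => decide ((tri L (tri l i).1).1 = (tri L (tri l 0).1).1)) &&
  (R8.all fun i => decide ((tri L (tri l i).2.2).1 = (tri L (tri l 0).2.2).1)) &&
  (R8.all fun i => memN L (tri L (tri l i).2.1).2.1 (tri l i).1) &&
  (R8.all fun i => memN L (tri L (tri l i).2.1).2.2 (tri l i).2.2) &&
  (R88.all fun p => !decide ((tri l p.1).1 = (tri l p.2).2.1)) &&
  (R88.all fun p => !decide ((tri l p.1).2.2 = (tri l p.2).2.1)) &&
  (R88.all fun p => decide (p.1 = p.2) ||
    (!decide ((tri l p.1).2.1 = (tri l p.2).2.1) && !decide ((tri l p.1).1 = (tri l p.2).1) &&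
      !decide ((tri l p.1).1 = (tri l p.2).2.2) && !decide ((tri l p.1).2.2 = (tri l p.2).2.2)))

/-- **The token-level test agrees with `packB`** on the list of a pack. -/
theorem packN_lOf (I : LocalMap 3 n m) (t : Pack m) : packN (trips I) (lOf t) = packB I t := by
  rw [Bool.eq_iff_iff]
  simp only [packN, Bool.and_eq_true, List.all_eq_true, forall_R8, forall_R88]
  simp only [tri_lOf, tri_lOf_zero, natTrip, tri_trips, tripOf_fst, tripOf_snd_fst, tripOf_snd_snd, memN,
    Bool.or_eq_true, Bool.and_eq_true, Bool.not_eq_true', decide_eq_true_eq, decide_eq_false_iff_not,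
    Fin.val_inj, packB, pset, Finset.mem_insert, Finset.mem_singleton, ne_eq, and_assoc, or_iff_not_imp_left]

/-- The pattern of position `i < 8` (the bits of `i`), on ℕ. -/
def patN (i : ℕ) : Bool × Bool × Bool :=
  (decide (i = 4) || decide (i = 5) || decide (i = 6) || decide (i = 7),
    decide (i = 2) || decide (i = 3) || decide (i = 6) || decide (i = 7),
    decide (i = 1) || decide (i = 3) || decide (i = 5) || decide (i = 7))

/-- `patN` agrees with `pat` on `Fin 8`. -/
theorem patN_val : ∀ i : Fin 8, patN i.val = pat i := by decide

/-- **The certificate answer on token data** at output `o`: middle `↦ β`, u-flank `↦ ¬α`, v-flank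
`↦ ¬γ` (in this priority), else `0`. -/
def ansBitN (l : List (ℕ × ℕ × ℕ)) (o : ℕ) : Bool :=
  (R8.find? fun i => decide ((tri l i).2.1 = o)).elim
    ((R8.find? fun i => decide ((tri l i).1 = o)).elim
      ((R8.find? fun i => decide ((tri l i).2.2 = o)).elim false fun i => !(patN i).2.2)
      fun i => !(patN i).1)
    fun i => (patN i).2.1

/-- The tabulated answer of a pack. -/
def ansPackN (m : ℕ) (l : List (ℕ × ℕ × ℕ)) : List Bool := (List.range m).map (ansBitN l)

/-- A search over `R8` is a search over `Fin 8`. -/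
theorem find?_R8 (P : ℕ → Bool) : R8.find? P = ((List.finRange 8).find? fun i => P i.val).map Fin.val := by
  rw [R8, ← List.map_coe_finRange_eq_range, List.find?_map]
  rfl

/-- `Option.elim` through `Option.map Fin.val`. -/
theorem elim_map_val {α : Type*} (o : Option (Fin 8)) (d : α) (g : ℕ → α) :
    (o.map Fin.val).elim d g = o.elim d fun i => g i.val := by
  cases o <;> rfl

/-- **The token-level answer agrees with `packAnswer`** on the list of a pack. -/
theorem ansBitN_lOf (t : Pack m) (o : Fin m) : ansBitN (lOf t) o.val = packAnswer t o := by
  simp only [ansBitN, find?_R8, elim_map_val, tri_lOf, natTrip, Fin.val_inj, patN_val, packAnswer]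

/-! ## The answer and its correctness -/

/-- **The answer on token data**: search the candidate packs, answer with the certificate of the first
aligned pack found, else `0ᵐ`. -/
def answer2 (m : ℕ) (L : List (ℕ × ℕ × ℕ)) : List Bool :=
  ((cands m).find? (packN L)).elim (ansNone m) (ansPackN m)

/-- **Correctness of the answer** on pure `CAND` matching-class instances with `headCount³ ≤ k·n`,
`n ≥ 1`, `m ≥ (22k+1)·n`. -/
theorem answer2_not_mem_range {I : LocalMap 3 n m} (hI : I.IsPure candPred) (hM : IsMatchingClass I) {k : ℕ}
    (hk : headCount I ^ 3 ≤ k * n) (hn : 0 < n) (hm : (22 * k + 1) * n ≤ m) :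
    readOut m (answer2 m (trips I)) ∉ I.range := by
  unfold answer2
  cases hf : (cands m).find? (packN (trips I)) with
  | none =>
    exfalso
    obtain ⟨t, ht⟩ := exists_pack hI hM hk hn hm
    have h := List.find?_eq_none.mp hf (lOf t) (lOf_mem t)
    rw [packN_lOf] at h
    exact h ht
  | some l =>
    have hP := List.find?_some hf
    obtain ⟨t, rfl⟩ := exists_eq_lOf (List.mem_of_find?_eq_some hf)
    rw [packN_lOf] at hP
    have he : readOut m (ansPackN m (lOf t)) = packAnswer t :=
      funext fun o => by rw [ansPackN, readOut_map_range, ansBitN_lOf]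
    simp only [Option.elim]
    rw [he]
    exact packAnswer_not_mem_range hI hP

/-- **The avoider as a string function**: tokenize, read the outputs, answer. -/
def avoidStr2 (w : List Bool) : List Bool := answer2 ((runs w).getD 1 0) (tripsTok (runs w))

/-- On the code of a pure `CAND` instance, `avoidStr2` is the answer on its outputs. -/
theorem avoidStr2_encode {I : LocalMap 3 n m} (hI : I.IsPure candPred) :
    avoidStr2 I.encode = answer2 m (trips I) := by
  rw [avoidStr2, runs_encode hI, toks_getD_one, tripsTok_toks]

end Summit.PneNP.PneNP.Theorems.Nc03AvoidResidualCoreCandMatchRungFP
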